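import Summits.BirchSwinnertonDyer.Rank1Residual.AdditivePotMult.ClassTheorems
import Literature.NumberTheory.EllipticCurves.BSDQuadraticDescentShaOddPartGeneralProofs
import HarnessLib

/-!
# X3♯(M) / X4(M): the relocation is EXACT — `ord_p #Ш_an(E_K) = ord_p #Ш_an(E) + ord_p #Ш_an(E^{(D)})`
# for odd `p`, and the typed over-`K` input is NECESSARY as well as sufficient

HONEST FRAMING (cell `b2b-bsdres`, run/shared/lean/b2b/bsd-rank1-residual/, verbatim in every
file): the goal of the cell is to DELETE the COMBINATION-SHAPED residual classes of the
Birch–Swinnerton-Dyer formula for ALL analytic-rank `≤ 1` elliptic curves over `ℚ` — "full BSD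
formula for every rank `≤ 1` curve in class `C`" assembled STRICTLY from published theorems — so
that the rank-`≤ 1` remainder becomes exactly the CONSTRUCTION-SHAPED classes, which are TYPED
(missing-input `Prop`s), NOT attempted. This is not "finishing BSD". Sub-cell
`b2b-bsdres-additive-p1`; research route, no claim beyond the stated sub-classes.

Theorems only. "DESCEND the p-part when `p ∤ [K:ℚ]` with exact control of the local terms
(Tamagawa numbers, torsion, periods under base change)" (the seat's brief): the control is EXACT and
needs no case analysis, because Milne's Weil-restriction identity (`hWR`, Literature fact
`Milne1972.bsdQuotient_baseChange_quadratic`) packages the period / regulator / Tamagawa / torsion /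
`Ш` changes between `E_K` and `(E, E^{(D)})` into one equation, and the tree's PROVED odd-part
theorem `card_primaryComponent_sha_baseChange_quadratic_of_odd_of_finite`
(`#Ш(E_K)[p^∞] = #Ш(E)[p^∞] · #Ш(E^{(D)})[p^∞]`, `p` odd, any rank; Dokchitser–Dokchitser 2010
Lemma 4.14 / JSW 2017 §7.4.1) splits off the `Ш`-term:

* `padicValNat_shaOrder_baseChange` — `ord_p #Ш(W') = ord_p #Ш(W) + ord_p #Ш(Wd)` (`p` odd, all finite);
* `padicValRat_shaAnOver_eq_add` — **for odd `p`: if `#Ш_an(W) = q` and `#Ш_an(Wd) = q_d` are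
  rational and non-zero then `#Ш_an(W') = q · q_d · #Ш(W')/(#Ш(W)#Ш(Wd))` is rational with
  `ord_p #Ш_an(W') = ord_p q + ord_p q_d`** — the combined local correction is a `p`-adic unit;
* `missingPPartOverAt_of_bsdp_of_bsdp` — conversely to the descent theorem, `BSD(W,p) ∧ BSD(Wd,p) ⟹
  MissingPPartOverAt W' p` (ANY `p`): the relocated input loses nothing;
* `missingPPartOverAt_iff_bsdp` — given `BSD(Wd, p)`: `MissingPPartOverAt W' p ↔ BSD(W, p)`.
-/

noncomputable section

open scoped Classical

open WeierstrassCurve Literature.NumberTheory.EllipticCurves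
  Literature.NumberTheory.EllipticCurves.Rank1Residual
  Literature.NumberTheory.EllipticCurves.Rank1Residual.Typed

namespace Summit.BirchSwinnertonDyer.Rank1Residual.AdditivePotMult

variable (W : WeierstrassCurve ℚ) [W.IsElliptic] (p : ℕ) [Fact p.Prime]
  (K : Type) [Field K] [NumberField K]
  (Wd : WeierstrassCurve ℚ) [Wd.IsElliptic] (W' : WeierstrassCurve K) [W'.IsElliptic]

/-- **`ord_p #Ш(E_K) = ord_p #Ш(E) + ord_p #Ш(E^{(D)})` for odd `p`** (all three finite): the tree's
`card_primaryComponent_sha_baseChange_quadratic_of_odd_of_finite` read through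
`#A[p^∞] = p^{ord_p #A}` (`padicValNat_card_addPrimaryComponent`). [folklore] -/
theorem padicValNat_shaOrder_baseChange (hp : p ≠ 2) (h2 : Module.finrank ℚ K = 2)
    (hWd : ∃ C : VariableChange ℚ, C • W.quadraticTwist (NumberField.discr K : ℚ) = Wd)
    (hW' : ∃ C : VariableChange K, C • W.baseChange K = W')
    (hshaW : W.ShaFinite) (hshaD : Wd.ShaFinite) (hshaK : W'.ShaFinite) :
    padicValNat p W'.shaOrder = padicValNat p W.shaOrder + padicValNat p Wd.shaOrder := by
  haveI : Finite W.sha := hshaW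
  haveI : Finite Wd.sha := hshaD
  haveI : Finite W'.sha := hshaK
  haveI : Finite (AddCommGroup.primaryComponent W.sha p) := Finite.of_injective _ Subtype.val_injective
  haveI : Finite (AddCommGroup.primaryComponent Wd.sha p) := Finite.of_injective _ Subtype.val_injective
  have h := card_primaryComponent_sha_baseChange_quadratic_of_odd_of_finite W K h2 Wd hWd W' hW' p hp
  have hv := congrArg (padicValNat p) h
  have hp0 : p ≠ 0 := (Fact.out : p.Prime).ne_zero
  rw [padicValNat.mul (by rw [card_addPrimaryComponent_eq_pow]; exact pow_ne_zero _ hp0)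
      (by rw [card_addPrimaryComponent_eq_pow]; exact pow_ne_zero _ hp0),
    padicValNat_card_addPrimaryComponent, padicValNat_card_addPrimaryComponent,
    padicValNat_card_addPrimaryComponent] at hv
  simpa [WeierstrassCurve.shaOrder] using hv

/-- **Exact control of the local terms, valuation form (odd `p`).** With Milne's identity `hWR`
and all three `Ш` finite: if `#Ш_an(W) = q` and `#Ш_an(Wd) = q_d` are rational and non-zero, then
`#Ш_an(W') = q q_d #Ш(W')/(#Ш(W) #Ш(Wd))` is rational and
**`ord_p #Ш_an(W') = ord_p q + ord_p q_d`** — the product of the period, regulator, Tamagawa and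
torsion corrections between `E_K/K` and `E, E^{(D)}/ℚ` is a `p`-adic unit. [folklore] -/
theorem padicValRat_shaAnOver_eq_add (hmod : hasEntireLFunction_rat) (hp : p ≠ 2)
    (h2 : Module.finrank ℚ K = 2)
    (hWd : ∃ C : VariableChange ℚ, C • W.quadraticTwist (NumberField.discr K : ℚ) = Wd)
    (hW' : ∃ C : VariableChange K, C • W.baseChange K = W')
    (hshaW : W.ShaFinite) (hshaD : Wd.ShaFinite) (hshaK : W'.ShaFinite)
    (hWR : (W'.shaOrder : ℝ) * W'.regulator * W'.bsdPeriod * (W'.tamagawaProduct : ℝ) /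
        (W'.torsionOrder : ℝ) ^ 2 = W.bsdRHS * Wd.bsdRHS)
    {q qd : ℚ} (hq : shaAn W = (q : ℂ)) (hqd : shaAn Wd = (qd : ℂ)) (hq0 : q ≠ 0) (hqd0 : qd ≠ 0) :
    shaAnOver W' = ((q * qd * W'.shaOrder / (W.shaOrder * Wd.shaOrder) : ℚ) : ℂ) ∧
      padicValRat p (q * qd * W'.shaOrder / (W.shaOrder * Wd.shaOrder)) =
        padicValRat p q + padicValRat p qd := by
  have hstar := shaAnOver_mul_eq W K Wd W' hmod h2 hWd hW' hshaW hshaD hshaK hWR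
  have hsW : W.shaOrder ≠ 0 := (W.shaOrder_pos hshaW).ne'
  have hsD : Wd.shaOrder ≠ 0 := (Wd.shaOrder_pos hshaD).ne'
  have hsK : W'.shaOrder ≠ 0 := (W'.shaOrder_pos hshaK).ne'
  refine ⟨?_, ?_⟩
  · have hden : (W.shaOrder : ℂ) * (Wd.shaOrder : ℂ) ≠ 0 :=
      mul_ne_zero (by exact_mod_cast hsW) (by exact_mod_cast hsD)
    push_cast
    rw [eq_div_iff hden, ← hq, ← hqd]
    linear_combination hstar
  · have hsWq : (W.shaOrder : ℚ) ≠ 0 := by exact_mod_cast hsW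
    have hsDq : (Wd.shaOrder : ℚ) ≠ 0 := by exact_mod_cast hsD
    have hsKq : (W'.shaOrder : ℚ) ≠ 0 := by exact_mod_cast hsK
    have hadd := padicValNat_shaOrder_baseChange W p K Wd W' hp h2 hWd hW' hshaW hshaD hshaK
    rw [padicValRat.div (mul_ne_zero (mul_ne_zero hq0 hqd0) hsKq) (mul_ne_zero hsWq hsDq),
      padicValRat.mul (mul_ne_zero hq0 hqd0) hsKq, padicValRat.mul hq0 hqd0,
      padicValRat.mul hsWq hsDq, padicValRat.of_nat, padicValRat.of_nat, padicValRat.of_nat, hadd]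
    push_cast
    ring

/-- **The relocated input is necessary (any `p`).** With Milne's identity and `E`, `E^{(D)}` of
analytic rank `≤ 1`: `BSD(W,p) ∧ BSD(Wd,p) ⟹ MissingPPartOverAt W' p`. By (★):
`#Ш_an(W') = q q_d #Ш(W')/(#Ш(W)#Ш(Wd))` with `ord_p q = ord_p #Ш(W)`, `ord_p q_d = ord_p #Ш(Wd)`.
[folklore] -/
theorem missingPPartOverAt_of_bsdp_of_bsdp
    (hGZK : rank_eq_analyticRank_of_analyticRank_le_one) (hmod : hasEntireLFunction_rat)
    (hr : W.analyticRank ≤ 1) (h2 : Module.finrank ℚ K = 2)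
    (hWd : ∃ C : VariableChange ℚ, C • W.quadraticTwist (NumberField.discr K : ℚ) = Wd)
    (hrd : Wd.analyticRank ≤ 1)
    (hW' : ∃ C : VariableChange K, C • W.baseChange K = W') (hshaK : W'.ShaFinite)
    (hWR : (W'.shaOrder : ℝ) * W'.regulator * W'.bsdPeriod * (W'.tamagawaProduct : ℝ) /
        (W'.torsionOrder : ℝ) ^ 2 = W.bsdRHS * Wd.bsdRHS)
    (hW : BSDp W p) (hd : BSDp Wd p) : MissingPPartOverAt W' p := by
  obtain ⟨-, hfinW⟩ := hGZK W hr
  obtain ⟨-, hfinD⟩ := hGZK Wd hrd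
  haveI : Finite W.sha := hfinW
  haveI : Finite Wd.sha := hfinD
  obtain ⟨q, hq, hv⟩ := missingPPartAt_of_bsdp W p hW
  obtain ⟨qd, hqd, hvd⟩ := missingPPartAt_of_bsdp Wd p hd
  have hstar := shaAnOver_mul_eq W K Wd W' hmod h2 hWd hW' hfinW hfinD hshaK hWR
  have hsW : W.shaOrder ≠ 0 := (W.shaOrder_pos hfinW).ne'
  have hsD : Wd.shaOrder ≠ 0 := (Wd.shaOrder_pos hfinD).ne'
  have hsK : W'.shaOrder ≠ 0 := (W'.shaOrder_pos hshaK).ne'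
  -- `q, qd ≠ 0`: `#Ш_an ≠ 0` since `L^* ≠ 0` and the invariants are positive
  have hne : ∀ (V : WeierstrassCurve ℚ) [V.IsElliptic] {x : ℚ}, shaAn V = (x : ℂ) → x ≠ 0 := by
    intro V _ x hx h0
    rw [h0, Rat.cast_zero, shaAn_def, div_eq_zero_iff] at hx
    rcases hx with h | h
    · rcases mul_eq_zero.mp h with h | h
      · exact V.leadingLCoeff_ne_zero_holds (hmod V) h
      · exact (pow_ne_zero 2 (by exact_mod_cast V.torsionOrder_pos_holds.ne' :
          (V.torsionOrder : ℂ) ≠ 0)) h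
    · rcases mul_eq_zero.mp h with h | h
      · rcases mul_eq_zero.mp h with h | h
        · exact (by exact_mod_cast V.realPeriodRat_pos_holds.ne' : (V.realPeriodRat : ℂ) ≠ 0) h
        · exact (by exact_mod_cast V.tamagawaProduct_pos_holds.ne' : (V.tamagawaProduct : ℂ) ≠ 0) h
      · exact (by exact_mod_cast V.regulator_pos'.ne' : (V.regulator : ℂ) ≠ 0) h
  have hq0 : q ≠ 0 := hne W hq
  have hqd0 : qd ≠ 0 := hne Wd hqd
  refine ⟨q * qd * W'.shaOrder / (W.shaOrder * Wd.shaOrder), ?_, ?_⟩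
  · have hden : (W.shaOrder : ℂ) * (Wd.shaOrder : ℂ) ≠ 0 :=
      mul_ne_zero (by exact_mod_cast hsW) (by exact_mod_cast hsD)
    push_cast
    rw [eq_div_iff hden, ← hq, ← hqd]
    linear_combination hstar
  · have hsWq : (W.shaOrder : ℚ) ≠ 0 := by exact_mod_cast hsW
    have hsDq : (Wd.shaOrder : ℚ) ≠ 0 := by exact_mod_cast hsD
    have hsKq : (W'.shaOrder : ℚ) ≠ 0 := by exact_mod_cast hsK
    rw [padicValRat.div (mul_ne_zero (mul_ne_zero hq0 hqd0) hsKq) (mul_ne_zero hsWq hsDq),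
      padicValRat.mul (mul_ne_zero hq0 hqd0) hsKq, padicValRat.mul hq0 hqd0,
      padicValRat.mul hsWq hsDq, padicValRat.of_nat, padicValRat.of_nat, padicValRat.of_nat, hv, hvd]
    ring

/-- **Equivalence.** Given `BSD(Wd, p)` for the twist (and the standing data), the typed over-`K`
input is EQUIVALENT to `BSD(W, p)`: the relocation X3♯(M)/X4(M) ↦ `MissingPPartOverAt` is exact.
[folklore] -/
theorem missingPPartOverAt_iff_bsdp
    (hGZK : rank_eq_analyticRank_of_analyticRank_le_one) (hmod : hasEntireLFunction_rat)
    (hr : W.analyticRank ≤ 1) (h2 : Module.finrank ℚ K = 2)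
    (hWd : ∃ C : VariableChange ℚ, C • W.quadraticTwist (NumberField.discr K : ℚ) = Wd)
    (hrd : Wd.analyticRank ≤ 1)
    (hW' : ∃ C : VariableChange K, C • W.baseChange K = W') (hshaK : W'.ShaFinite)
    (hWR : (W'.shaOrder : ℝ) * W'.regulator * W'.bsdPeriod * (W'.tamagawaProduct : ℝ) /
        (W'.torsionOrder : ℝ) ^ 2 = W.bsdRHS * Wd.bsdRHS)
    (hd : BSDp Wd p) : MissingPPartOverAt W' p ↔ BSDp W p :=
  ⟨fun hK => bsdp_of_pPartOver_of_bsdp_twist W p K Wd W' hGZK hmod hr h2 hWd hrd hW' hshaK hWR hK hd,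
   fun hW => missingPPartOverAt_of_bsdp_of_bsdp W p K Wd W' hGZK hmod hr h2 hWd hrd hW' hshaK hWR hW hd⟩

end Summit.BirchSwinnertonDyer.Rank1Residual.AdditivePotMult

end
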